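import Summits.QuantumFields.YangMills.Theorems.SwapVirialDeficitSigmaTwistedLetterCeiling
import Summits.QuantumFields.YangMills.Theorems.SwapVirialDeficitSwapRingCeilingLaplace
import HarnessLib

/-!
# The fixed-`L` CEILING of the σ-glued ring, IV: the zero σ-sector UNCONDITIONALLY — `μ_L{F^S_0 ≤ u} ≤ C_L·u^{9L⁴−1}`, `∫e^{−βF^S_0}dμ_L ≤ C_L/β^{9L⁴−1}`
# (free-hands support of item stmt-QuantumFields-24197; instantiation of ✓`swap_volume/laplace_ceiling_of_leaderCeiling` with LEAD ym-line-sfw-p2 g93's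
# σ-twisted four-leader ceiling ✓`SigmaTwistedCeiling.haar_pi_sigmaTwisted_le` through the bridge ✓`swapCommSet_subset_quat`)
* `swap_leaderCeiling_frob` — LEAD's quaternion-form ceiling read on the Frobenius event (`Eσ_F(s) ⊆ Eσ_q(s/√2)`, `(s/√2)⁷ ≤ s⁷`);
* ★★★ `swap_volume_ceiling`, ★★★ `swap_laplace_ceiling` — with ✓`swap_volume_floor` / ✓`swap_laplace_floor_of_leaderVolume` + ✓`swapCommVolume` the zero
  σ-sector of the swap-glued femto ring is TWO-SIDED at every fixed `L`: `μ_L{F^S_0 ≤ u} ≍ u^{9L⁴−1}`, `∫e^{−βF^S_0}dμ_L ≍ β^{−(9L⁴−1)}` — NO logarithm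
  (swap-central cone of commuting triples + one slaved letter, RLCT `9L⁴ − 1`, multiplicity `1`), against the periodic `≍ u^{9L⁴−3/2}·log u⁻¹`
  (✓`PeriodicRingFloor.log_volume_floor` / ✓`PeriodicRingCeiling.log_volume_ceiling`).  This is sector `0`'s `hvol` input of the (B-v) assembly
  ✓`swap_twistTrace_ceiling_of_sectorVolumes`; the seven twisted σ-sectors are the remaining inputs.
HONEST LABEL: sector `z = 0` only, fixed `L`, constants `exp(O(L⁴ log L))`; the `TT.twistTrace` ceiling and ⟨24197⟩, ⟨24194⟩, ⟨24497⟩, ⟨24196⟩ stay OPEN;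
no crux, rung or summit is proved; the Yang–Mills mass gap is NOT proved; no summit is proved by a line.  THEOREMS ONLY (0 `def`, 0 `sorry`), standard axioms.
Width seat ym-line-sfw-p2-w3 g61 (cell ym-idea-1, free hands), `--supports stmt-QuantumFields-24197`.
References: [cite: tHooft1979]; [cite: Luscher1983, §2]; [cite: Vanbaal2001]; [cite: GonzalezarroyoAltes1988]; [folklore].
-/

set_option autoImplicit false

noncomputable section

open MeasureTheory
open scoped BigOperators ENNReal Quaternion
open Literature.MathematicalPhysics.QuantumFieldTheory hiding SU2 su2Quat_mul
open Literature.MathematicalPhysics.QuantumLattice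

namespace Summit.QuantumFields.YangMills.Theorems.SwapVirialDeficit.SwapRing

open Summit.QuantumFields.YangMills.Theorems.FemtoTransferGap
open Summit.QuantumFields.YangMills.Theorems.FemtoTransferGap.TT
open Summit.QuantumFields.YangMills.Theorems.VirialFluxGap.RingDeficit

variable {L : ℕ} [NeZero L]

/-- The σ-twisted four-leader ceiling in FROBENIUS form: `Haar⁴{Eσ_F(s)} ≤ C·s⁷` on `(0, √2·t₀]` from LEAD g93's quaternion-form ceiling
(`Eσ_F(s) ⊆ Eσ_q(s/√2)` ✓`swapCommSet_subset_quat`, `(s/√2)⁷ ≤ s⁷`). [folklore] -/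
theorem swap_leaderCeiling_frob :
    ∃ C : ℝ, 0 < C ∧ ∃ s₀ : ℝ, 0 < s₀ ∧ ∀ s : ℝ, 0 < s → s ≤ s₀ →
      (Measure.pi fun _ : Fin 4 => haarProbability SU2).real {C : Fin 4 → SU2 |
        (∀ μ ν : Fin 3, frobNorm (((C (Fin.castSucc μ) * C (Fin.castSucc ν) : SU2) : Matrix (Fin 2) (Fin 2) ℂ) -
          ((C (Fin.castSucc ν) * C (Fin.castSucc μ) : SU2) : Matrix (Fin 2) (Fin 2) ℂ)) ≤ s) ∧
        ∀ μ : Fin 3, frobNorm (((C (Fin.last 3) * C (Fin.castSucc (Equiv.swap (0 : Fin 3) 1 μ)) : SU2) : Matrix (Fin 2) (Fin 2) ℂ) -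
          ((C (Fin.castSucc μ) * C (Fin.last 3) : SU2) : Matrix (Fin 2) (Fin 2) ℂ)) ≤ s} ≤ C * s ^ 7 := by
  obtain ⟨C, hC, t₀, ht₀, h⟩ := SigmaTwistedCeiling.haar_pi_sigmaTwisted_le
  haveI : IsProbabilityMeasure (Measure.pi fun _ : Fin 4 => haarProbability SU2) := inferInstance
  have h2 : (0 : ℝ) < Real.sqrt 2 := Real.sqrt_pos.2 (by norm_num)
  have h21 : (1 : ℝ) ≤ Real.sqrt 2 := by rw [Real.le_sqrt' one_pos]; norm_num
  refine ⟨C, hC, Real.sqrt 2 * t₀, by positivity, fun s hs hss => ?_⟩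
  have hs' : 0 < s / Real.sqrt 2 := div_pos hs h2
  have hst : s / Real.sqrt 2 ≤ t₀ := by rw [div_le_iff₀ h2]; linarith
  have hle : s / Real.sqrt 2 ≤ s := div_le_self hs.le h21
  calc _ ≤ (Measure.pi fun _ : Fin 4 => haarProbability SU2).real {C : Fin 4 → SU2 |
          (∀ μ ν : Fin 3, ‖su2Quat (C μ.castSucc) * su2Quat (C ν.castSucc) - su2Quat (C ν.castSucc) * su2Quat (C μ.castSucc)‖ ≤ s / Real.sqrt 2) ∧
          ∀ μ : Fin 3, ‖su2Quat (C (Fin.last 3)) * su2Quat (C (Equiv.swap (0 : Fin 3) 1 μ).castSucc) -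
            su2Quat (C μ.castSucc) * su2Quat (C (Fin.last 3))‖ ≤ s / Real.sqrt 2} :=
        measureReal_mono (swapCommSet_subset_quat s) (measure_ne_top _ _)
    _ ≤ C * (s / Real.sqrt 2) ^ 7 := h _ hs' hst
    _ ≤ C * s ^ 7 := mul_le_mul_of_nonneg_left (pow_le_pow_left₀ hs'.le hle 7) hC.le

/-- ★★★ **Zero σ-sector volume ceiling, unconditional**: `μ_L{F^S_0 ≤ u} ≤ C_L·u^{9L⁴−1}` on `(0, u₀]`, NO logarithm. [cite: tHooft1979] [cite: Luscher1983, §2] -/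
theorem swap_volume_ceiling (L : ℕ) [NeZero L] :
    ∃ C : ℝ, 0 < C ∧ ∃ u₀ : ℝ, 0 < u₀ ∧ ∀ u : ℝ, 0 < u → u ≤ u₀ →
      (ringMeasure L).real {P | swapRingDeficit L (fun _ => false) P ≤ u} ≤ C * u ^ (9 * L ^ 4 - 1) := by
  obtain ⟨C, hC, s₀, hs₀, hceil⟩ := swap_leaderCeiling_frob
  exact swap_volume_ceiling_of_leaderCeiling (L := L) hC.le hs₀ hceil

/-- ★★★ **Zero σ-sector Laplace ceiling, unconditional**: `∫e^{−βF^S_0}dμ_L ≤ C_L/β^{9L⁴−1}` for all `β > 0`; with ✓`swap_laplace_floor_of_leaderVolume`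
+ ✓`swapCommVolume` the zero σ-sector weight is `≍ e^{12βL⁴}β^{−(9L⁴−1)}` two-sided at fixed `L`. [cite: tHooft1979] [cite: Luscher1983, §2] [cite: Vanbaal2001] -/
theorem swap_laplace_ceiling (L : ℕ) [NeZero L] :
    ∃ C : ℝ, 0 < C ∧ ∀ β : ℝ, 0 < β →
      ∫ P, Real.exp (-(β * swapRingDeficit L (fun _ => false) P)) ∂(ringMeasure L) ≤ C / β ^ (9 * L ^ 4 - 1) := by
  obtain ⟨C, hC, s₀, hs₀, hceil⟩ := swap_leaderCeiling_frob
  exact swap_laplace_ceiling_of_leaderCeiling (L := L) hC.le hs₀ hceil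

end Summit.QuantumFields.YangMills.Theorems.SwapVirialDeficit.SwapRing

end
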